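import Summits.AnomalousDissipation.AnomalousDissipation.Theorems.SolenoidalFractalHomogenisationLagrangianStepWEvenCertBlock
import HarnessLib

/-!
# K1L_D IS-half · E1-CERT v2 port, part 3/5: slot geometry of the cubature word, the flat sectorial charge, the scalar classes {100}, {111}

Summits-side PORT (prover seat `ad-sawtooth-k1loc-p1` g12; tenure E1-LAND 2026-08-29T00:31:55Z) of planner ad-ideate-p5 g12's certificate spine
`Cruxes/LagrangianRenormalisationStep/Lines/onelevel_W_evenSlack_cert.lean` v2 (commit 88965dfa39cf; the mathematics, the numerics `evencert.py` / kit j321011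
and the custody `HOME/ad-ideate-p5/k1l-even-cert/` are p5's) for the IS-half obligation `stub_W_evenSlackB : ∃ a > 0, WCrossing.EvenSlackWindowB a WCrossing.ρB`
of K1L_D `stub_cellLawV0_IS` (stmt-AnomalousDissipation-27980).  The port states everything over the LANDED `WCrossing` definitions
(`…LagrangianStepWCrossing`, prover ad-k1loc-p3 g7) instead of the spine's §W copies and wires the spine's three analytic stubs to landed theorems
(`stub_oddEven ↦ oddEven_qsResp` p681750, `stub_N110U/L ↦ encl_N110U/L` p682297, point enclosures `↦ encl_N1xx` p681405); texts otherwise VERBATIM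
(namespace `…LagrangianStep.WEvenCert`).  NOT a proof of `stub_cellLawV0_IS`, of the crux K1L_D, of Onsager's conjecture or of anomalous dissipation;
rung leaf F-D1.A0.

Part 3: §3.5 slot geometry lemmas (`norm_sq_m`, `slotQ_eq`, `Tj_pos`, `oddCharge_le`, `slot_oddEven`), §3.6 `slot_upper_scalar`/`slot_lower_scalar`.
-/

set_option linter.dupNamespace false

noncomputable section

namespace Summit.AnomalousDissipation.AnomalousDissipation.Theorems.SolenoidalFractalHomogenisation.LagrangianStep.WEvenCert

open Summit.AnomalousDissipation.AnomalousDissipation.Theorems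
open Summit.AnomalousDissipation.AnomalousDissipation.Theorems.SolenoidalFractalHomogenisation.LagrangianStep
open Summit.AnomalousDissipation.AnomalousDissipation.Theorems.SolenoidalFractalHomogenisation.LagrangianStep.WCrossing
open Literature.Analysis Literature.Analysis.FluidPDE Literature.Analysis.FunctionSpaces
open Literature.Algebra.EuclideanLattices (norm_sq_fin_three)
open Set Real

/-! ### §3.5 Slot geometry of the cubature word: unit wave vector, relaxation number, coordinates -/


/-- `norm_sq_m` (E1-CERT v2 spine §3.5–§3.6, p5 g12). -/
theorem norm_sq_m (j : Fin 26) : ‖Torus.latticeVec (slots j).m‖ ^ 2 = Mq (slots j) := by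
  rw [norm_sq_fin_three]; simp only [Torus.latticeVec_apply, Mq]

/-- `Mq_cases` (E1-CERT v2 spine §3.5–§3.6, p5 g12). -/
theorem Mq_cases (j : Fin 26) : Mq (slots j) = 1 ∨ Mq (slots j) = 2 ∨ Mq (slots j) = 3 := by
  fin_cases j <;> simp [slots, Mq, Matrix.cons_val_zero, Matrix.cons_val_one, Matrix.cons_val_two, Matrix.head_cons, Matrix.tail_cons] <;> norm_num

/-- `Mq_pos` (E1-CERT v2 spine §3.5–§3.6, p5 g12). -/
theorem Mq_pos (j : Fin 26) : 0 < Mq (slots j) := by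
  rcases Mq_cases j with h | h | h <;> rw [h] <;> norm_num

/-- `norm_m_pos` (E1-CERT v2 spine §3.5–§3.6, p5 g12). -/
theorem norm_m_pos (j : Fin 26) : 0 < ‖Torus.latticeVec (slots j).m‖ := by
  have h1 := norm_sq_m j; have h2 := Mq_pos j
  have h3 := norm_nonneg (Torus.latticeVec (slots j).m)
  by_contra h; push Not at h
  have : ‖Torus.latticeVec (slots j).m‖ = 0 := le_antisymm h h3
  rw [this] at h1; norm_num at h1; linarith

/-- `nj_apply` (E1-CERT v2 spine §3.5–§3.6, p5 g12). -/
theorem nj_apply (j : Fin 26) (a : Fin 3) : nj j a = ((slots j).m a : ℝ) / ‖Torus.latticeVec (slots j).m‖ := by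
  show (Torus.latticeVec (slots j).m) a / ‖Torus.latticeVec (slots j).m‖ = _
  rw [Torus.latticeVec_apply]

/-- `nj_mul` (E1-CERT v2 spine §3.5–§3.6, p5 g12). -/
theorem nj_mul (j : Fin 26) (a b : Fin 3) : nj j a * nj j b = ((slots j).m a : ℝ) * (slots j).m b / Mq (slots j) := by
  rw [nj_apply, nj_apply, div_mul_div_comm, ← sq, norm_sq_m]

/-- `hn_j` (E1-CERT v2 spine §3.5–§3.6, p5 g12). -/
theorem hn_j (j : Fin 26) : ∑ a, nj j a ^ 2 = 1 := sum_mhat_sq _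

/-- `dot_nj` (E1-CERT v2 spine §3.5–§3.6, p5 g12). -/
theorem dot_nj (j : Fin 26) (w : Fin 3 → ℝ) : ∑ i, nj j i * w i = mdot (slots j) w / ‖Torus.latticeVec (slots j).m‖ := by
  simp only [Fin.sum_univ_three, nj_apply, mdot]; ring

/-- `dot_nj'` (E1-CERT v2 spine §3.5–§3.6, p5 g12). -/
theorem dot_nj' (j : Fin 26) (w : Fin 3 → ℝ) : ∑ i, w i * nj j i = mdot (slots j) w / ‖Torus.latticeVec (slots j).m‖ := by
  rw [← dot_nj]; exact Finset.sum_congr rfl fun i _ => mul_comm _ _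

/-- `dot_nj_sq` (E1-CERT v2 spine §3.5–§3.6, p5 g12). -/
theorem dot_nj_sq (j : Fin 26) (w : Fin 3 → ℝ) : (∑ i, w i * nj j i) ^ 2 = mdot (slots j) w ^ 2 / Mq (slots j) := by
  rw [dot_nj', div_pow, norm_sq_m]

/-- `perp_iff` (E1-CERT v2 spine §3.5–§3.6, p5 g12). -/
theorem perp_iff (j : Fin 26) (w : Fin 3 → ℝ) : ∑ i, nj j i * w i = 0 ↔ mdot (slots j) w = 0 := by
  rw [dot_nj, div_eq_zero_iff]; exact or_iff_left (norm_m_pos j).ne'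

/-- `nsq_eq` (E1-CERT v2 spine §3.5–§3.6, p5 g12). -/
theorem nsq_eq (w : Fin 3 → ℝ) : ∑ i, w i ^ 2 = nsq w := by simp [Fin.sum_univ_three, nsq]

/-- `|P_j p|² = PpM/M`. -/
theorem perp_sq (j : Fin 26) (p : Fin 3 → ℝ) : ∑ i, p i ^ 2 - (∑ i, p i * nj j i) ^ 2 = PpM (slots j) p / Mq (slots j) := by
  rw [dot_nj_sq, nsq_eq]; unfold PpM nsq mdot
  have := (Mq_pos j).ne'
  field_simp

/-- `projPerp_nj_apply` (E1-CERT v2 spine §3.5–§3.6, p5 g12). -/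
theorem projPerp_nj_apply (j : Fin 26) (w : Fin 3 → ℝ) (c : Fin 3) :
    (projPerp (nj j)).mulVec w c = w c - ((slots j).m c : ℝ) * mdot (slots j) w / Mq (slots j) := by
  rw [projPerp_mulVec, dot_nj, nj_apply, div_mul_div_comm, ← sq, norm_sq_m, mul_div_assoc]

/-- `symb Sc (n_j, w) = |w|² + (κc/M) Σ_c m_c² w_c²` (`|n_j| = 1`). -/
theorem symb_Sc_nj (j : Fin 26) (w : Fin 3 → ℝ) : Torus.symb Sc (nj j) w = nsq w + κc / Mq (slots j) * I1m (slots j) w := by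
  rw [symb_Sc]
  have e : ∀ c, nj j c ^ 2 = ((slots j).m c : ℝ) ^ 2 / Mq (slots j) := fun c => by rw [sq, nj_mul, sq]
  have h1 : Nkp (nj j) w = nsq w := by
    have h := hn_j j
    simp only [Fin.sum_univ_three] at h
    unfold Nkp nsq; rw [h, one_mul]
  rw [h1]; unfold I1 I1m; rw [e 0, e 1, e 2]
  have := (Mq_pos j).ne'
  field_simp

/-- the slot response matrix in the `(T_j, n_j)` vocabulary (ramp `½`). -/
theorem slotQ_eq (S : T4) (j : Fin 26) : slotQ cubatureWord MB S j = qsResp (1 / 2) (Tj j) (regBlock S (nj j)) * projPerp (nj j) := by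
  show qsResp (1 / 2) (4 * Real.pi ^ 2 * ‖Torus.latticeVec (slots j).m‖ ^ 2 * MB * ((slots j).τ : ℝ)) (regBlock S (nj j)) * projPerp (nj j) = _
  rw [norm_sq_m]; rfl

/-- `Tj_pos` (E1-CERT v2 spine §3.5–§3.6, p5 g12). -/
theorem Tj_pos (j : Fin 26) : 0 < Tj j := by
  have h := (slots_ok j).2.2.2.2
  have hτ : (0:ℝ) < (slots j).τ := by exact_mod_cast h
  have := Mq_pos j
  unfold Tj MB; positivity

/-- the sectorial charge: `ω²/b³ = (τλ/2)²/(slo/λ)³ ≤ τ₀²Λ_w⁵/(4 slo³) ≤ ℓ̄`. -/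
theorem oddCharge_le {lam τ : ℝ} (hlam : lam ∈ Icc lam0 LamW) (hτ : τ ∈ Icc 0 τ0c) :
    (τ * lam / 2) ^ 2 / (sloC / lam) ^ 3 ≤ ellBar := by
  have hl0 : 0 < lam := lt_of_lt_of_le lam0_pos hlam.1
  have hslo : (0:ℝ) < sloC := by unfold sloC; norm_num
  have h1 : (τ * lam / 2) ^ 2 / (sloC / lam) ^ 3 = τ ^ 2 * lam ^ 5 / (4 * sloC ^ 3) := by
    field_simp; ring
  have h2 : τ ^ 2 ≤ τ0c ^ 2 := pow_le_pow_left₀ hτ.1 hτ.2 2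
  have h3 : lam ^ 5 ≤ LamW ^ 5 := pow_le_pow_left₀ hl0.le hlam.2 5
  have h4 : τ ^ 2 * lam ^ 5 ≤ τ0c ^ 2 * LamW ^ 5 := mul_le_mul h2 h3 (by positivity) (by positivity)
  rw [h1]
  calc τ ^ 2 * lam ^ 5 / (4 * sloC ^ 3) ≤ τ0c ^ 2 * LamW ^ 5 / (4 * sloC ^ 3) := div_le_div_of_nonneg_right h4 (by positivity)
    _ ≤ ellBar := by unfold τ0c LamW sloC ellBar; norm_num

/-- S2 at a slot: `|pᵀQ_j(S)p − pᵀQ_j(½(S+Sᵀ))p| ≤ ℓ̄ |P_j p|²`. -/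
theorem slot_oddEven {lam τ : ℝ} (hlam : lam ∈ Icc lam0 LamW) (hτ : τ ∈ Icc 0 τ0c) {S : T4}
    (hI : InInterval Sc lam S) (hO : OddSectorial S τ) (j : Fin 26) (p : Fin 3 → ℝ) :
    |∑ i, ∑ i', p i * slotQ cubatureWord MB S j i i' * p i' - ∑ i, ∑ i', p i * slotQ cubatureWord MB (symS S) j i i' * p i'|
      ≤ ellBar * (∑ i, p i ^ 2 - (∑ i, p i * nj j i) ^ 2) := by
  have hn := hn_j j
  have hl1 : 1 ≤ lam := le_trans (by unfold lam0; norm_num) hlam.1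
  have hl0 : 0 < lam := by linarith
  have hslo : (0:ℝ) < sloC := by unfold sloC; norm_num
  rw [slotQ_eq, slotQ_eq, sum_sum_mul_qsResp_regBlock_projPerp hn, sum_sum_mul_qsResp_regBlock_projPerp hn, regBlock_symS,
    ← sum_sq_projPerp_mulVec hn]
  set v := (projPerp (nj j)).mulVec p
  have hfloor : ∀ w : Fin 3 → ℝ, sloC / lam * ∑ i, w i ^ 2 ≤ ∑ i, ∑ j', w i * regBlock S (nj j) i j' * w j' :=
    fun w => regBlock_floor_of_inInterval hn hl1 (by rw [div_le_one hl0]; exact le_trans (by unfold sloC; norm_num) hl1)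
      (fun w hw => by
        have h := (nearIso_Sc (nj j) w (by rw [← hw]; exact Finset.sum_congr rfl fun i _ => mul_comm _ _)).1
        rw [hn, one_mul] at h; exact h) hI w
  have hskew := regBlock_skew hn hτ.1 hl1 hI hO
  have h := stub_oddEven (ρ := 1 / 2) (T := Tj j) (b := sloC / lam) (ω := τ * lam / 2) (regBlock S (nj j)) (div_pos hslo hl0) hfloor hskew
    (by norm_num) (by norm_num) (Tj_pos j).le v
  exact h.trans (mul_le_mul_of_nonneg_right (oddCharge_le hlam hτ) (by positivity))

/-! ### §3.6 Scalar classes {100}, {111}: block window `α = β` exact, pinch + ray reduction + point enclosure -/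

/-- UPPER, scalar class: `pᵀQ_j(S)p ≤ (λ/λ₀)(U' + ℓ̄)|P_j p|²` when `symb Sc (n_j,·) = α|·|²` on `n_j^⊥` and `f_{T_j}(α/λ₀) ≤ U'`. -/
theorem slot_upper_scalar {lam τ : ℝ} (hlam : lam ∈ Icc lam0 LamW) (hτ : τ ∈ Icc 0 τ0c) {S : T4}
    (hI : InInterval Sc lam S) (hO : OddSectorial S τ) (j : Fin 26) {α Up : ℝ}
    (hα0 : 0 < α) (hα1 : α ≤ 1)
    (hwin : ∀ w : Fin 3 → ℝ, ∑ i, nj j i * w i = 0 → Torus.symb Sc (nj j) w = α * ∑ i, w i ^ 2)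
    (hNU : qsRespScalar (1 / 2) (Tj j) (α / lam0) ≤ Up) (p : Fin 3 → ℝ) :
    ∑ i, ∑ i', p i * slotQ cubatureWord MB S j i i' * p i'
      ≤ lam / lam0 * ((Up + ellBar) * (∑ i, p i ^ 2 - (∑ i, p i * nj j i) ^ 2)) := by
  have hn := hn_j j
  have hl1 : 1 ≤ lam := le_trans (by unfold lam0; norm_num) hlam.1
  have hl0 : 0 < lam := by linarith
  have hodd := (abs_sub_le_iff.1 (slot_oddEven hlam hτ hI hO j p)).1
  have hP0 : 0 ≤ ∑ i, p i ^ 2 - (∑ i, p i * nj j i) ^ 2 := by rw [← sum_sq_projPerp_mulVec hn]; positivity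
  -- symmetric part: pinch at the floor α/λ
  have hsym : ∑ i, ∑ i', p i * slotQ cubatureWord MB (symS S) j i i' * p i'
      ≤ qsRespScalar (1 / 2) (Tj j) (α / lam) * (∑ i, p i ^ 2 - (∑ i, p i * nj j i) ^ 2) := by
    rw [slotQ_eq]
    exact slotForm_le_of_inInterval (oddSmall_symS S) hn hl1 (by rw [div_le_one hl0]; linarith)
      (fun w hw => (hwin w hw).ge) (inInterval_symS hI) (Tj_pos j).le p
  -- ray: f(α/λ) ≤ (λ/λ₀) f(α/λ₀) ≤ (λ/λ₀) U'
  have hray := qsRespScalar_div_antitone_ray (ρ := 1 / 2) (T := Tj j) (β := α) (by norm_num) (by norm_num) (Tj_pos j) hα0 lam0_pos hlam.1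
  have hf : qsRespScalar (1 / 2) (Tj j) (α / lam) ≤ lam / lam0 * Up := by
    rw [div_le_iff₀ hl0] at hray
    calc qsRespScalar (1 / 2) (Tj j) (α / lam) ≤ qsRespScalar (1 / 2) (Tj j) (α / lam0) / lam0 * lam := hray
      _ ≤ Up / lam0 * lam := mul_le_mul_of_nonneg_right (div_le_div_of_nonneg_right hNU lam0_pos.le) hl0.le
      _ = lam / lam0 * Up := by ring
  have hll : 1 ≤ lam / lam0 := by rw [le_div_iff₀ lam0_pos, one_mul]; exact hlam.1
  have h1 : qsRespScalar (1 / 2) (Tj j) (α / lam) * (∑ i, p i ^ 2 - (∑ i, p i * nj j i) ^ 2)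
      ≤ lam / lam0 * Up * (∑ i, p i ^ 2 - (∑ i, p i * nj j i) ^ 2) := mul_le_mul_of_nonneg_right hf hP0
  have h2 : ellBar * (∑ i, p i ^ 2 - (∑ i, p i * nj j i) ^ 2) ≤ lam / lam0 * ellBar * (∑ i, p i ^ 2 - (∑ i, p i * nj j i) ^ 2) := by
    apply mul_le_mul_of_nonneg_right _ hP0
    have : (0:ℝ) ≤ ellBar := by unfold ellBar; norm_num
    nlinarith
  nlinarith [hodd, hsym, h1, h2]

/-- LOWER, scalar class: `(1/λ)(L' − Λ_w ℓ̄)|P_j p|² ≤ pᵀQ_j(S)p` when `symb Sc (n_j,·) = α|·|²` on `n_j^⊥`, `1 ≤ λ₀α`, `L' ≤ λ₀ f_{T_j}(λ₀α)`. -/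
theorem slot_lower_scalar {lam τ : ℝ} (hlam : lam ∈ Icc lam0 LamW) (hτ : τ ∈ Icc 0 τ0c) {S : T4}
    (hI : InInterval Sc lam S) (hO : OddSectorial S τ) (j : Fin 26) {α Lp : ℝ}
    (hα0 : 0 < α) (hlamα : 1 ≤ lam0 * α)
    (hwin : ∀ w : Fin 3 → ℝ, ∑ i, nj j i * w i = 0 → Torus.symb Sc (nj j) w = α * ∑ i, w i ^ 2)
    (hNL : Lp ≤ lam0 * qsRespScalar (1 / 2) (Tj j) (lam0 * α)) (p : Fin 3 → ℝ) :
    1 / lam * ((Lp - LamW * ellBar) * (∑ i, p i ^ 2 - (∑ i, p i * nj j i) ^ 2))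
      ≤ ∑ i, ∑ i', p i * slotQ cubatureWord MB S j i i' * p i' := by
  have hn := hn_j j
  have hl1 : 1 ≤ lam := le_trans (by unfold lam0; norm_num) hlam.1
  have hl0 : 0 < lam := by linarith
  have hodd := (abs_sub_le_iff.1 (slot_oddEven hlam hτ hI hO j p)).2
  have hP0 : 0 ≤ ∑ i, p i ^ 2 - (∑ i, p i * nj j i) ^ 2 := by rw [← sum_sq_projPerp_mulVec hn]; positivity
  have hsym : qsRespScalar (1 / 2) (Tj j) (lam * α) * (∑ i, p i ^ 2 - (∑ i, p i * nj j i) ^ 2)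
      ≤ ∑ i, ∑ i', p i * slotQ cubatureWord MB (symS S) j i i' * p i' := by
    rw [slotQ_eq]
    exact slotForm_ge_of_inInterval (oddSmall_symS S) hn hl1 (le_trans hlamα (mul_le_mul_of_nonneg_right hlam.1 hα0.le))
      (fun w hw => (hwin w hw).le) (inInterval_symS hI) (Tj_pos j).le p
  have hray := mul_qsRespScalar_mul_mono_ray (ρ := 1 / 2) (T := Tj j) (β := α) (by norm_num) (by norm_num) (Tj_pos j) hα0 lam0_pos hlam.1
  -- λ₀ f(λ₀α) ≤ λ f(λα) ⇒ (1/λ) L' ≤ f(λα)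
  have hf : 1 / lam * Lp ≤ qsRespScalar (1 / 2) (Tj j) (lam * α) := by
    rw [one_div, ← div_eq_inv_mul, div_le_iff₀ hl0]; linarith
  have hE : (0:ℝ) ≤ ellBar := by unfold ellBar; norm_num
  have h1 : 1 / lam * Lp * (∑ i, p i ^ 2 - (∑ i, p i * nj j i) ^ 2)
      ≤ qsRespScalar (1 / 2) (Tj j) (lam * α) * (∑ i, p i ^ 2 - (∑ i, p i * nj j i) ^ 2) := mul_le_mul_of_nonneg_right hf hP0
  have h2 : ellBar * (∑ i, p i ^ 2 - (∑ i, p i * nj j i) ^ 2) ≤ 1 / lam * (LamW * ellBar) * (∑ i, p i ^ 2 - (∑ i, p i * nj j i) ^ 2) := by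
    apply mul_le_mul_of_nonneg_right _ hP0
    rw [one_div, ← div_eq_inv_mul, le_div_iff₀ hl0]
    nlinarith [hlam.2]
  nlinarith [hodd, hsym, h1, h2]



end Summit.AnomalousDissipation.AnomalousDissipation.Theorems.SolenoidalFractalHomogenisation.LagrangianStep.WEvenCert
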